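import Summits.QuantumFields.YangMills.Theses.ColdStartUniversality
import HarnessLib

/-!
# Route `ColdStartUniversality` (rung R3 `YM3TorusSU2`, RECORD): THE DECIDING COMPOSITION NEEDS K_A2 ONLY ON THE
# CENTRE-NEUTRAL SECTOR — `NeutralColdStartMixing → ColdStartContinuumCauchy|Γ → YM3TorusSU2`

Helper file (seat `ym-line-csu-p1`, g14; `--supports stmt-QuantumFields-24810`).  The rev-3 deciding theorem
`Theses.ColdStartUniversality.closes` splits every loop string by centre charge: CHARGED strings (odd total winding in
some direction) have `expectAt K os = 0` at every cut-off (`T3CentreSymmetry.expectAt_eq_zero_of_odd_SU2`) — a constant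
sequence, no dynamics; only NEUTRAL strings run the cold-start argument, where K_A1|Γ (`NeutralColdStartMixing`, 27363)
and K_A2 (`ColdStartContinuumCauchy`, 24810) are used.  The route restricted K_A1 to the neutral sector (rev 3) but kept
K_A2 on ALL strings.  This file kernel-checks that K_A2, too, is needed only on centre-even strings:

* ★ `ym3TorusSU2_of_neutral_of_cauchyEven_of_exist` — `NeutralColdStartMixing → ColdStartContinuumCauchy|Γ →
  ColdStartSolutionsExist → YM3TorusSU2`, where `ColdStartContinuumCauchy|Γ` is item 24810 VERBATIM with the single
  extra hypothesis `∀ μ, Even (os.map (wind μ)).sum` on the loop string (spelled inline; no new definition);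
  the support S is a theorem of the tree (`Summit.QuantumFields.YangMills.Theorems.ColdStartSolutionsExist_proof`, p618112;
  not imported here to keep this file out of the Theorems-over-Theses cone);
* `cauchyEven_of_coldStartContinuumCauchy` — the restriction is implied by item 24810 as typed (a fortiori).

So the planner may re-type K_A2 on the neutral sector (the charged-sector Cauchy property — by
`CentreCovariance.integral_string_eq_half_sub_of_odd` a statement about the MERGING of the dynamics started from the cold
start and from a twisted classical vacuum — is not needed for the rung).  THEOREMS ONLY; custody information; no crux,
rung or summit statement is proved here and the Yang–Mills mass gap is NOT proved.
-/

set_option autoImplicit false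

noncomputable section

namespace Summit.QuantumFields.YangMills.Theorems.ColdStartUniversality

open MeasureTheory Filter Topology
open Summit.QuantumFields.YangMills.Theses.ColdStartUniversality

/-- **K_A2 on ALL strings implies K_A2 on the centre-neutral strings** (a fortiori). [folklore] -/
theorem cauchyEven_of_coldStartContinuumCauchy (hA2 : ColdStartContinuumCauchy) :
    ∀ (F : Literature.MathematicalPhysics.QuantumFieldTheory.Balaban1983to89.T3ContinuumYM3Torus.T3Family) (γ : ℝ), 0 < γ → ∀ (os : List (Literature.MathematicalPhysics.QuantumFieldTheory.Balaban1983to89.T3ContinuumYM3Torus.ULoop3 F)), (∀ μ : Fin 3, Even (os.map (Literature.MathematicalPhysics.QuantumFieldTheory.Balaban1983to89.T3ContinuumYM3Torus.ULoop3.wind μ)).sum) → ∀ (T : ℝ), 0 < T → ∀ (a : ℕ → ℝ), (∀ K : ℕ, ∃ (Ω : Type) (_mΩ : MeasurableSpace Ω) (P : MeasureTheory.Measure Ω) (_hP : MeasureTheory.IsProbabilityMeasure P) (W : NNReal → Ω → (Literature.MathematicalPhysics.QuantumFieldTheory.Edge 3 ((F.P K).sitesPerDir 0) × Literature.MathematicalPhysics.QuantumFieldTheory.NoiseIdx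 2 → ℝ)) (hW : Literature.MathematicalPhysics.QuantumFieldTheory.IsFlatBrownian W P) (U : NNReal → Ω → Literature.MathematicalPhysics.QuantumFieldTheory.GaugeConfig 3 ((F.P K).sitesPerDir 0) (Matrix.specialUnitaryGroup (Fin 2) ℂ)), (∀ ω, U 0 ω = fun _ => 1) ∧ (Literature.MathematicalPhysics.QuantumFieldTheory.latticeLangevinDynamics (⟨2, Literature.MathematicalPhysics.QuantumLattice.fundamentalRep (Fin 2), Literature.MathematicalPhysics.QuantumLattice.continuous_fundamentalRep _, Literature.MathematicalPhysics.QuantumLattice.fundamentalRep_injective _, Literature.MathematicalPhysics.QuantumLattice.fundamentalRep_mem_unitaryGroup⟩ : Literature.MathematicalPhysics.QuantumFieldTheory.LatticeRep (Matrix.specialUnitaryGroup (Fin 2) ℂ)) ((γ * (F.P K).eps)⁻¹ / 2)).IsSolution (Literature.MathematicalPhysics.QuantumLattice.fundamentalRep (Fin 2)) hW.natFiltration P W U ∧ a K = T⁻¹ * intervalIntegral (fun s : ℝ => MeasureTheory.integral P (fun ω => (os.map fun C => F.avgObs (Literature.MathematicalPhysics.QuantumFieldTheory.Balaban1983to89.ExpMeanLog.expMeanLogSU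 : Literature.MathematicalPhysics.QuantumFieldTheory.Balaban1983to89.LoopAverage (Matrix.specialUnitaryGroup (Fin 2) ℂ)) K C (fun b : Literature.MathematicalPhysics.QuantumFieldTheory.Balaban1983to89.PBond (F.P K) 0 => U (s / (F.P K).eps).toNNReal ω (b.src, b.dir))).prod)) 0 T MeasureTheory.volume) → CauchySeq a := fun F γ hγ os _ T hT a ha => hA2 F γ hγ os T hT a ha

/-- ★★ **THE RUNG FROM K_A1|Γ, K_A2|Γ AND S.**  `NeutralColdStartMixing` (27363), K_A2 RESTRICTED TO CENTRE-EVEN loop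
strings (item 24810 verbatim + the hypothesis `∀ μ, Even (os.map (wind μ)).sum`) and `ColdStartSolutionsExist` (24811)
imply the R3 leaf `YM3TorusSU2` — the rev-3 deciding argument verbatim, observing that K_A2 is invoked only in the
neutral branch. [cite: tHooft1979Flux, §2] -/
theorem ym3TorusSU2_of_neutral_of_cauchyEven_of_exist (hN1 : NeutralColdStartMixing)
    (hA2 : ∀ (F : Literature.MathematicalPhysics.QuantumFieldTheory.Balaban1983to89.T3ContinuumYM3Torus.T3Family) (γ : ℝ), 0 < γ → ∀ (os : List (Literature.MathematicalPhysics.QuantumFieldTheory.Balaban1983to89.T3ContinuumYM3Torus.ULoop3 F)), (∀ μ : Fin 3, Even (os.map (Literature.MathematicalPhysics.QuantumFieldTheory.Balaban1983to89.T3ContinuumYM3Torus.ULoop3.wind μ)).sum) → ∀ (T : ℝ), 0 < T → ∀ (a : ℕ → ℝ), (∀ K : ℕ, ∃ (Ω : Type) (_mΩ : MeasurableSpace Ω) (P : MeasureTheory.Measure Ω) (_hP : MeasureTheory.IsProbabilityMeasure P) (W : NNReal → Ω → (Literature.MathematicalPhysics.QuantumFieldTheory.Edge 3 ((F.P K).sitesPerDir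 0) × Literature.MathematicalPhysics.QuantumFieldTheory.NoiseIdx 2 → ℝ)) (hW : Literature.MathematicalPhysics.QuantumFieldTheory.IsFlatBrownian W P) (U : NNReal → Ω → Literature.MathematicalPhysics.QuantumFieldTheory.GaugeConfig 3 ((F.P K).sitesPerDir 0) (Matrix.specialUnitaryGroup (Fin 2) ℂ)), (∀ ω, U 0 ω = fun _ => 1) ∧ (Literature.MathematicalPhysics.QuantumFieldTheory.latticeLangevinDynamics (⟨2, Literature.MathematicalPhysics.QuantumLattice.fundamentalRep (Fin 2), Literature.MathematicalPhysics.QuantumLattice.continuous_fundamentalRep _, Literature.MathematicalPhysics.QuantumLattice.fundamentalRep_injective _, Literature.MathematicalPhysics.QuantumLattice.fundamentalRep_mem_unitaryGroup⟩ : Literature.MathematicalPhysics.QuantumFieldTheory.LatticeRep (Matrix.specialUnitaryGroup (Fin 2) ℂ)) ((γ * (F.P K).eps)⁻¹ / 2)).IsSolution (Literature.MathematicalPhysics.QuantumLattice.fundamentalRep (Fin 2)) hW.natFiltration P W U ∧ a K = T⁻¹ * intervalIntegral (fun s : ℝ => MeasureTheory.integral P (fun ω => (os.map fun C => F.avgObs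 (Literature.MathematicalPhysics.QuantumFieldTheory.Balaban1983to89.ExpMeanLog.expMeanLogSU : Literature.MathematicalPhysics.QuantumFieldTheory.Balaban1983to89.LoopAverage (Matrix.specialUnitaryGroup (Fin 2) ℂ)) K C (fun b : Literature.MathematicalPhysics.QuantumFieldTheory.Balaban1983to89.PBond (F.P K) 0 => U (s / (F.P K).eps).toNNReal ω (b.src, b.dir))).prod)) 0 T MeasureTheory.volume) → CauchySeq a)
    (hEx : ColdStartSolutionsExist) :
    Literature.MathematicalPhysics.QuantumFieldTheory.Balaban1983to89.T3YM3TorusStatement.YM3TorusSU2 := by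
  obtain ⟨γ₁, hγ₁, h1⟩ := hN1
  refine ⟨γ₁, hγ₁, fun F γ hγ hγle => ?_⟩
  rw [Literature.MathematicalPhysics.QuantumFieldTheory.Balaban1983to89.T3ContinuumYM3Torus.continuumYM3Torus_iff_hasContinuumLimit_SU
    F _ Literature.MathematicalPhysics.QuantumFieldTheory.Balaban1983to89.T4ApexTwoLevel.measurableE_expMeanLogSU hγ.le]
  intro os
  set e : ℕ → ℝ := fun K =>
    (F.scheme (Literature.MathematicalPhysics.QuantumFieldTheory.Balaban1983to89.ExpMeanLog.expMeanLogSU :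
      Literature.MathematicalPhysics.QuantumFieldTheory.Balaban1983to89.LoopAverage (Matrix.specialUnitaryGroup (Fin 2) ℂ)) γ).expectAt
      K os with he
  -- CHARGED SECTOR: exact vanishing at every cut-off (centre symmetry), hence a constant sequence.
  by_cases hodd : ∃ μ : Fin 3,
      Odd (os.map (Literature.MathematicalPhysics.QuantumFieldTheory.Balaban1983to89.T3ContinuumYM3Torus.ULoop3.wind μ)).sum
  · obtain ⟨μ, hμ⟩ := hodd
    have h0 : e = fun _ => 0 := funext fun K =>
      Literature.MathematicalPhysics.QuantumFieldTheory.Balaban1983to89.T3ContinuumYM3Torus.expectAt_eq_zero_of_odd_SU2 F _ γ K hμ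
    exact ⟨0, by rw [h0]; exact tendsto_const_nhds⟩
  -- NEUTRAL SECTOR: the cold-start argument, with BOTH dynamical hypotheses restricted to neutral strings.
  have hev : ∀ μ : Fin 3,
      Even (os.map (Literature.MathematicalPhysics.QuantumFieldTheory.Balaban1983to89.T3ContinuumYM3Torus.ULoop3.wind μ)).sum :=
    fun μ => Int.not_odd_iff_even.mp fun h => hodd ⟨μ, h⟩
  have hcs : CauchySeq e := by
    refine Metric.cauchySeq_iff.mpr fun ε hε => ?_
    obtain ⟨T, hT, K₀, hK₀⟩ := h1 F γ hγ hγle os hev (ε / 4) (by positivity)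
    choose Ω mΩ P hP W hW U hU0 hUsol using fun K => hEx F γ K hγ
    set a : ℕ → ℝ := fun K => T⁻¹ * intervalIntegral (fun s : ℝ => MeasureTheory.integral (P K) fun ω =>
      (os.map fun C => F.avgObs
        (Literature.MathematicalPhysics.QuantumFieldTheory.Balaban1983to89.ExpMeanLog.expMeanLogSU :
          Literature.MathematicalPhysics.QuantumFieldTheory.Balaban1983to89.LoopAverage (Matrix.specialUnitaryGroup (Fin 2) ℂ)) K C
        (fun b : Literature.MathematicalPhysics.QuantumFieldTheory.Balaban1983to89.PBond (F.P K) 0 =>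
          U K (s / (F.P K).eps).toNNReal ω (b.src, b.dir))).prod) 0 T MeasureTheory.volume with ha
    have hac : CauchySeq a := hA2 F γ hγ os hev T hT a fun K =>
      ⟨Ω K, mΩ K, P K, hP K, W K, hW K, U K, hU0 K, hUsol K, rfl⟩
    obtain ⟨N₁, hN₁⟩ := Metric.cauchySeq_iff.mp hac (ε / 4) (by positivity)
    refine ⟨max K₀ N₁, fun m hm n hn => ?_⟩
    have hm₁ : |e m - a m| ≤ ε / 4 :=
      hK₀ m (le_of_max_le_left hm) (Ω m) (mΩ m) (P m) (hP m) (W m) (hW m) (U m) (hU0 m) (hUsol m)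
    have hn₁ : |e n - a n| ≤ ε / 4 :=
      hK₀ n (le_of_max_le_left hn) (Ω n) (mΩ n) (P n) (hP n) (W n) (hW n) (U n) (hU0 n) (hUsol n)
    have hmn : dist (a m) (a n) < ε / 4 := hN₁ m (le_of_max_le_right hm) n (le_of_max_le_right hn)
    rw [Real.dist_eq] at hmn ⊢
    calc |e m - e n| = |(e m - a m) + (a m - a n) - (e n - a n)| := by ring_nf
      _ ≤ |(e m - a m) + (a m - a n)| + |e n - a n| := abs_sub _ _
      _ ≤ |e m - a m| + |a m - a n| + |e n - a n| := by gcongr; exact abs_add_le _ _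
      _ < ε := by linarith
  exact cauchySeq_tendsto_of_complete hcs

end Summit.QuantumFields.YangMills.Theorems.ColdStartUniversality

end
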